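import Summits.ResolutionOfSingularities.ResolutionOfSingularities.Theorems.PurelyInseparableDim4ChartAtlasSNCFarRepairTranslated
import Summits.ResolutionOfSingularities.ResolutionOfSingularities.Theorems.PurelyInseparableDim4ChartAtlasSNCDisjointRepairs
import HarnessLib

/-!
# Purely inseparable four-folds `z^p + F(x₁, …, x₄)`: THE FAR-RESONANCE REPAIR AT ANY FINITE NUMBER OF HEIGHTS IN ONE STEP (cell
# `res-dim4-pi`, typ-2 g7; HANDOFF OPEN 2 «resonances at several heights», memo S3-N2-SNC-CRITERION §11:20Z rider «k ≥ 3 heights: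
# induct on the finite set of resonant heights»)

[OURS · counted 0] (D-0157 DOOR 2; DR-157-C.) Chart model of the escaping step in R1's frame (p706678: `y_j ↦ y_j − c′`, old exceptional
hyperplane at `y_j = c′`): boundary `E` of hyperplanes `(y_m + a)·𝒪`, `(m, a) ∈ H₀`, and translated far quadrics
`TQ_k = ((y_k + b_k)·y_j − c′·y_k + e_k)·𝒪`, `k ∈ fs ∌ j`, `e_k + b_k c′ ≠ 0`; escaping centre `Zc = V(y_0, y_T)` (`j ∉ T`). A member is AT
HEIGHT `h` if it is the hyperplane `y_j − h` or a quadric `TQ_k`, `k ∈ T`, with `e_k + b_k h = 0`; it then meets `Zc` only inside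
`Σ_h = Zc ∩ {y_j = h} = V(ψ_{−h}^*𝓘(Σ′))` (p717520). For a finite list `hs` of pairwise distinct heights (all `≠ c′`) the loci `Σ_h` are
pairwise disjoint and `C(hs) = Π_{h ∈ hs} ψ_{−h}^*𝓘(Σ′)` cuts out `⊔_h Σ_h`. PROVED here (no `sorry`, no new axiom):

* `mem_support_prod_heights_iff`, `disjoint_support_heights` — `V(C(hs)) = ⋃_h Σ_h`; `Σ_h ∩ V(C(hs′)) = ∅` for `h ∉ hs′`;
* `hasSNCWith_prod_heights`, `isRegular_subscheme_prod_heights`, `support_prod_heights_subset` — `C(hs)` IS AN ADMISSIBLE REPAIR CENTRE: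
  the chart-model boundary is snc with it (F1's translated R1 at every height + Literature `HasSNCWith.mul_of_disjoint`), `V(C(hs))` is
  regular (Literature `isRegular_subscheme_prod_of_pairwise_disjoint`), and `V(C(hs)) ⊆ Zc`;
* **`admissible_strictTransform_after_manyHeights_farRepair`** — for ANY blowing up `π` of `𝔸⁵` along `C(hs)` (`hs ≠ []`):
  `C' = St_π(Zc)` is REGULAR, `V(C') ⊆ supp(((z^p + F)·𝒪, E, p).transform π C(hs))`, and
  `HasSNCWith (E.map St_π ++ [π^*C(hs)]) C'`, under R4's provenance hypotheses with the height conditions asked only OFF the heights in `hs`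
  (index-`j` hyperplanes `y_j + a` with `a + h ≠ 0` for all `h ∈ hs`; active far members with `e_k + b_k h ≠ 0` for all `h ∈ hs`). By
  induction on `hs`: one height is p717520 (R5 at that height); `h :: hs′` is p716496 `admissible_strictTransform_of_disjoint_repairs` with
  `C₁ = ψ_{−h}^*𝓘(Σ′)` (boundary minus the members at the heights of `hs′`) and `C₂ = C(hs′)` (induction hypothesis with the boundary minus the
  members at height `h`);
* `admissible_strictTransform_after_manyHeights_farRepair'` — the same as the BGMW Def. 3.1.3 (1)(2) triple for `M' = M.transform π C(hs)`.

WORDS: «resonances of the escaping centre with far old members at ANY finite number of heights are removed by ONE extra blow-up along the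
disjoint union of the resonance loci (a regular centre snc with the boundary); afterwards the strict transform of the centre is admissible;
cost rider r5 once per height» — HANDOFF OPEN 2 of typ-2 g6 CLOSED on the chart model. Nothing here is a statement about resolution of
singularities in dimension ≥ 4 / characteristic `p` (NOT proved anywhere in this programme). bears_on: LADDER-RESOLUTION:D157-DOOR2 (res-dim4-pi).
Supports stmt-ResolutionOfSingularities-16155 (helper).
-/

-- every declaration of this summit lives under `Summit.ResolutionOfSingularities.ResolutionOfSingularities`
-- (summit = problem), which the duplicate-namespace linter flags; house convention (cf. the Target file).
set_option linter.dupNamespace false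

noncomputable section

open MvPolynomial CategoryTheory AlgebraicGeometry TopologicalSpace
open AlgebraicGeometry.Scheme.IdealSheafData (ofIdealTop)

namespace Summit.ResolutionOfSingularities.ResolutionOfSingularities.Theorems.PIDim4

open Literature.AlgebraicGeometry.Resolution
open Literature.AlgebraicGeometry.Resolution.AffinePointBlowup (P A γ)

namespace ChartDictionary

variable {K : Type} [Field K] {p : ℕ} {T : Finset (Fin 4)} {j : Fin 4} {b e : Fin 4 → K} {c' : K}

/-! ## §1 The centre `C(hs) = Π_{h ∈ hs} ψ_{−h}^*𝓘(Σ′)` -/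

/-- `V(C(hs)) = ⋃_{h ∈ hs} Σ_h`: membership in the support of the product. -/
theorem mem_support_prod_heights_iff (hs : List K) (x : P 4 K) :
    x ∈ ((hs.map fun h => (AffineCoordBlowup.𝓘Λ 4 K (insert 0 (Fin.succ '' ((insert j T : Finset (Fin 4)) : Set (Fin 4))))).comap
      (Spec.map (CommRingCat.ofHom ((AffinePointBlowup.translateEquiv (n := 4) (Pi.single j.succ (-h)) : A 4 K ≃ₐ[K] A 4 K) :
        A 4 K →+* A 4 K)))).prod).support ↔
      ∃ h ∈ hs, x ∈ ((AffineCoordBlowup.𝓘Λ 4 K (insert 0 (Fin.succ '' ((insert j T : Finset (Fin 4)) : Set (Fin 4))))).comap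
        (Spec.map (CommRingCat.ofHom ((AffinePointBlowup.translateEquiv (n := 4) (Pi.single j.succ (-h)) : A 4 K ≃ₐ[K] A 4 K) :
          A 4 K →+* A 4 K)))).support := by
  rw [← SetLike.mem_coe, IdealSheafData.coe_support_prod, Set.mem_iUnion₂]
  constructor
  · rintro ⟨I, hI, hx⟩
    obtain ⟨h, hh, rfl⟩ := List.mem_map.mp hI
    exact ⟨h, hh, hx⟩
  · rintro ⟨h, hh, hx⟩
    exact ⟨_, List.mem_map.mpr ⟨h, hh, rfl⟩, hx⟩

/-- **Resonance loci at different heights are disjoint**: `Σ_h ∩ V(C(hs′)) = ∅` for `h ∉ hs′` (a point of both has `y_j − h` and `y_j − h′` in its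
prime for some `h′ ∈ hs′`, hence the non-zero constant `h′ − h`). -/
theorem disjoint_support_heights {h : K} {hs : List K} (hnh : h ∉ hs) :
    Disjoint (((AffineCoordBlowup.𝓘Λ 4 K (insert 0 (Fin.succ '' ((insert j T : Finset (Fin 4)) : Set (Fin 4))))).comap
      (Spec.map (CommRingCat.ofHom ((AffinePointBlowup.translateEquiv (n := 4) (Pi.single j.succ (-h)) : A 4 K ≃ₐ[K] A 4 K) :
        A 4 K →+* A 4 K)))).support : Set (P 4 K))
      ((hs.map fun h' => (AffineCoordBlowup.𝓘Λ 4 K (insert 0 (Fin.succ '' ((insert j T : Finset (Fin 4)) : Set (Fin 4))))).comap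
        (Spec.map (CommRingCat.ofHom ((AffinePointBlowup.translateEquiv (n := 4) (Pi.single j.succ (-h')) : A 4 K ≃ₐ[K] A 4 K) :
          A 4 K →+* A 4 K)))).prod).support := by
  rw [Set.disjoint_left]
  intro x hx hx'
  obtain ⟨h', hh', hx'⟩ := (mem_support_prod_heights_iff hs x).mp hx'
  have hjΛ : j.succ ∈ (insert 0 (Fin.succ '' ((insert j T : Finset (Fin 4)) : Set (Fin 4))) : Set (Fin (4 + 1))) :=
    Set.mem_insert_of_mem _ ⟨j, Finset.mem_coe.mpr (Finset.mem_insert_self j T), rfl⟩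
  have h1 := (mem_support_comap_spec_translate_𝓘Λ_iff (-h) _ x).mp hx j.succ hjΛ
  have h2 := (mem_support_comap_spec_translate_𝓘Λ_iff (-h') _ x).mp hx' j.succ hjΛ
  rw [Pi.single_eq_same] at h1 h2
  have h3 := x.asIdeal.sub_mem h1 h2
  have e1 : (X j.succ + C (-h) - (X j.succ + C (-h')) : A 4 K) = C (h' - h) := by
    rw [map_sub, map_neg, map_neg]; ring
  rw [e1, C_mem_asIdeal_iff, sub_eq_zero] at h3
  exact hnh (h3 ▸ hh')

/-- **The chart-model boundary is snc with `C(hs)`** for pairwise distinct heights `hs ≠ []`, all `≠ c′` (F1's translated R1 at every height,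
glued by Literature `HasSNCWith.mul_of_disjoint`). -/
theorem hasSNCWith_prod_heights (hjT : j ∉ T) (hs : List K) (hne : hs ≠ []) (hnd : hs.Nodup) (hch : ∀ h ∈ hs, c' - h ≠ 0)
    (H : Finset (Fin (4 + 1) × K)) (fs : Finset (Fin 4)) (hjfs : j ∉ fs) (hd : ∀ k ∈ fs, e k + b k * c' ≠ 0)
    (hC1 : ∀ k ∈ fs, ∀ a : K, (k.succ, a) ∈ H → a = b k) {E : List (Scheme.IdealSheafData (P 4 K))}
    (hE : ∀ D ∈ E, D = ⊤ ∨ (∃ ma ∈ H, D = ofIdealTop (Ideal.span {(γ 4 K).symm (X ma.1 + C ma.2)})) ∨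
      ∃ k ∈ fs, D = ofIdealTop (Ideal.span {(γ 4 K).symm ((X k.succ + C (b k)) * X j.succ - C c' * X k.succ + C (e k))})) :
    HasSNCWith E (hs.map fun h => (AffineCoordBlowup.𝓘Λ 4 K (insert 0 (Fin.succ '' ((insert j T : Finset (Fin 4)) : Set (Fin 4))))).comap
      (Spec.map (CommRingCat.ofHom ((AffinePointBlowup.translateEquiv (n := 4) (Pi.single j.succ (-h)) : A 4 K ≃ₐ[K] A 4 K) :
        A 4 K →+* A 4 K)))).prod := by
  induction hs with
  | nil => exact absurd rfl hne
  | cons h hs' ih =>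
    obtain ⟨hnh, hnd'⟩ := List.nodup_cons.mp hnd
    have h1 := hasSNCWith_𝓘Λ_insert_comap_translate_of_forall_mem_far_translated hjT (hch h (List.mem_cons.mpr (Or.inl rfl))) H fs hjfs
      hd hC1 hE
    rw [List.map_cons, List.prod_cons]
    by_cases hnil : hs' = []
    · subst hnil
      rw [List.map_nil, List.prod_nil, mul_one]
      exact h1
    · exact HasSNCWith.mul_of_disjoint (disjoint_support_heights hnh) h1
        (ih hnil hnd' fun h' hh' => hch h' (List.mem_cons.mpr (Or.inr hh')))

/-- **`V(C(hs))` is a regular scheme** for pairwise distinct heights (each `Σ_h ≅ V(y_0, y_T, y_j)` is regular, p695335; Literature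
`isRegular_subscheme_prod_of_pairwise_disjoint`). -/
theorem isRegular_subscheme_prod_heights (hs : List K) (hnd : hs.Nodup) :
    Scheme.IsRegular (hs.map fun h => (AffineCoordBlowup.𝓘Λ 4 K (insert 0 (Fin.succ '' ((insert j T : Finset (Fin 4)) : Set (Fin 4))))).comap
      (Spec.map (CommRingCat.ofHom ((AffinePointBlowup.translateEquiv (n := 4) (Pi.single j.succ (-h)) : A 4 K ≃ₐ[K] A 4 K) :
        A 4 K →+* A 4 K)))).prod.subscheme := by
  refine isRegular_subscheme_prod_of_pairwise_disjoint _ (fun I hI => ?_) ?_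
  · obtain ⟨h, -, rfl⟩ := List.mem_map.mp hI
    haveI : IsIso (CommRingCat.ofHom ((AffinePointBlowup.translateEquiv (n := 4) (Pi.single j.succ (-h)) : A 4 K ≃ₐ[K] A 4 K) :
        A 4 K →+* A 4 K)) :=
      (inferInstance : IsIso (AffinePointBlowup.translateEquiv (n := 4)
        (Pi.single j.succ (-h)) : A 4 K ≃ₐ[K] A 4 K).toRingEquiv.toCommRingCatIso.hom)
    exact isRegular_subscheme_comap_𝓘Λ _ _
  · induction hs with
    | nil => simp
    | cons h hs' ih =>
      obtain ⟨hnh, hnd'⟩ := List.nodup_cons.mp hnd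
      rw [List.map_cons, List.pairwise_cons]
      refine ⟨fun J hJ => ?_, ih hnd'⟩
      obtain ⟨h', hh', rfl⟩ := List.mem_map.mp hJ
      have hne : h ∉ [h'] := fun hm => hnh ((List.mem_singleton.mp hm) ▸ hh')
      have hdj := disjoint_support_heights (K := K) (T := T) (j := j) hne
      rwa [List.map_cons, List.map_nil, List.prod_cons, List.prod_nil, mul_one] at hdj

/-- `V(C(hs)) ⊆ Zc = V(y_0, y_T)` (`j ∉ T`): the repair centre lies inside the escaping centre. -/
theorem support_prod_heights_subset (hjT : j ∉ T) (hs : List K) :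
    ((hs.map fun h => (AffineCoordBlowup.𝓘Λ 4 K (insert 0 (Fin.succ '' ((insert j T : Finset (Fin 4)) : Set (Fin 4))))).comap
      (Spec.map (CommRingCat.ofHom ((AffinePointBlowup.translateEquiv (n := 4) (Pi.single j.succ (-h)) : A 4 K ≃ₐ[K] A 4 K) :
        A 4 K →+* A 4 K)))).prod.support : Set (P 4 K)) ⊆
      (AffineCoordBlowup.𝓘Λ 4 K (insert 0 (Fin.succ '' (T : Set (Fin 4))))).support := by
  intro x hx
  obtain ⟨h, -, hx⟩ := (mem_support_prod_heights_iff hs x).mp hx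
  rw [mem_support_comap_spec_translate_𝓘Λ_iff] at hx
  rw [SetLike.mem_coe, AffineCoordBlowup.support_𝓘Λ, AffineCoordBlowup.mem_CΛ_iff']
  intro i hi
  have hij : i ≠ j.succ := fun heq => hjT ((succ_mem_centreVars_iff T j).mp (heq ▸ hi))
  have h1 := hx i (centreVars_subset_centreVars_insert T j hi)
  rwa [Pi.single_eq_of_ne hij, C_0, add_zero] at h1

/-! ## §2 The repair at any finite number of heights -/

/-- **THE FAR-RESONANCE REPAIR AT ANY FINITE NUMBER OF HEIGHTS IN ONE STEP** (chart model, R1's frame; `j ∉ T`; heights `hs ≠ []` pairwise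
distinct, each `≠ c′`). Boundary: hyperplanes `(m, a) ∈ H₀` (provenance `(k⁺, a) ∈ H₀ → a = b_k` on far indices) and translated far quadrics
`TQ_k`, `k ∈ fs ∌ j`, `e_k + b_k c′ ≠ 0`; the height conditions are asked only OFF the heights of `hs`: no index-`j` hyperplane `y_j + a` with
`a + h ≠ 0` (`h ∈ hs`) at the height of an active member with `e_k + b_k h ≠ 0` (`h ∈ hs`), and pairwise distinct heights among those members.
Then for ANY blowing up `π : W → 𝔸⁵` along `Cn = C(hs) = Π_{h ∈ hs} ψ_{−h}^*𝓘(Σ′)`: `St_π(V(y_0, y_T))` is REGULAR, inside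
`supp(((z^p + F)·𝒪, E, p).transform π Cn)` (`z^p + F` `T`-permissible, `T ≠ ∅`), and snc with `E.map St_π ++ [π^*Cn]`. Induction on `hs`
(base p717520; step p716496 with the boundary split by heights). Resolution of singularities in dimension ≥ 4 / characteristic `p` is NOT
proved. -/
theorem admissible_strictTransform_after_manyHeights_farRepair (hjT : j ∉ T) (hs : List K) (hne : hs ≠ []) (hnd : hs.Nodup)
    (hch : ∀ h ∈ hs, c' - h ≠ 0) (H₀ : Finset (Fin (4 + 1) × K)) (fs : Finset (Fin 4)) (hjfs : j ∉ fs)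
    (hd : ∀ k ∈ fs, e k + b k * c' ≠ 0) (hC1 : ∀ k ∈ fs, ∀ a : K, (k.succ, a) ∈ H₀ → a = b k)
    (hHj : ∀ a : K, (j.succ, a) ∈ H₀ → (∀ h ∈ hs, a + h ≠ 0) →
      ∀ k ∈ fs, k ∈ T → (∀ h ∈ hs, e k + b k * h ≠ 0) → b k ≠ 0 → e k ≠ a * b k)
    (hNh : ∀ k ∈ fs, ∀ k' ∈ fs, k ∈ T → k' ∈ T → (∀ h ∈ hs, e k + b k * h ≠ 0) → (∀ h ∈ hs, e k' + b k' * h ≠ 0) → k ≠ k' →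
      b k ≠ 0 → b k' ≠ 0 → e k * b k' ≠ e k' * b k)
    {k₀ : Fin 4} (hk₀ : k₀ ∈ T) {E : List (Scheme.IdealSheafData (P 4 K))}
    (hE : ∀ D ∈ E, D = ⊤ ∨ (∃ ma ∈ H₀, D = ofIdealTop (Ideal.span {(γ 4 K).symm (X ma.1 + C ma.2)})) ∨
      ∃ k ∈ fs, D = ofIdealTop (Ideal.span {(γ 4 K).symm ((X k.succ + C (b k)) * X j.succ - C c' * X k.succ + C (e k))}))
    (F : MvPolynomial (Fin 4) K) (hperm : (p : ℕ∞) ≤ CentreBlowup.ordAlong T F) {Cn : Scheme.IdealSheafData (P 4 K)}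
    (hCn : Cn = (hs.map fun h => (AffineCoordBlowup.𝓘Λ 4 K (insert 0 (Fin.succ '' ((insert j T : Finset (Fin 4)) : Set (Fin 4))))).comap
      (Spec.map (CommRingCat.ofHom ((AffinePointBlowup.translateEquiv (n := 4) (Pi.single j.succ (-h)) : A 4 K ≃ₐ[K] A 4 K) :
        A 4 K →+* A 4 K)))).prod)
    {W : Scheme.{0}} {π : W ⟶ P 4 K} (hπ : IsBlowup π Cn) :
    Scheme.IsRegular (strictTransformIdeal π Cn (AffineCoordBlowup.𝓘Λ 4 K (insert 0 (Fin.succ '' (T : Set (Fin 4)))))).subscheme ∧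
      ((strictTransformIdeal π Cn (AffineCoordBlowup.𝓘Λ 4 K (insert 0 (Fin.succ '' (T : Set (Fin 4)))))).support : Set W) ⊆
        ((⟨hypSheaf p F, E, p⟩ : MarkedIdeal (P 4 K)).transform π Cn).support ∧
      HasSNCWith (E.map (strictTransformIdeal π Cn) ++ [Cn.comap π])
        (strictTransformIdeal π Cn (AffineCoordBlowup.𝓘Λ 4 K (insert 0 (Fin.succ '' (T : Set (Fin 4)))))) := by
  induction hs generalizing H₀ fs E Cn W with
  | nil => exact absurd rfl hne
  | cons h hs' ih =>
    classical
    obtain ⟨hnh, hnd'⟩ := List.nodup_cons.mp hnd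
    have hch' : c' - h ≠ 0 := hch h (List.mem_cons.mpr (Or.inl rfl))
    rw [List.map_cons, List.prod_cons] at hCn
    by_cases hnil : hs' = []
    · -- ONE HEIGHT: R5 at the height `h` (p717520)
      subst hnil
      rw [List.map_nil, List.prod_nil, mul_one] at hCn
      subst hCn
      refine admissible_strictTransform_after_farRepair_translated (b := b) (e := e) (c' := c') (δ := h) hjT hch' H₀ fs hjfs hd hC1
        ?_ ?_ hk₀ hE F hperm hπ
      · intro a ha hah k hk hkT hek hbk
        exact hHj a ha (fun h' hh' => by rw [List.mem_singleton.mp hh']; exact hah) k hk hkT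
          (fun h' hh' => by rw [List.mem_singleton.mp hh']; exact hek) hbk
      · intro k hk k' hk' hkT hk'T hek hek' hkk hbk hbk'
        exact hNh k hk k' hk' hkT hk'T (fun h' hh' => by rw [List.mem_singleton.mp hh']; exact hek)
          (fun h' hh' => by rw [List.mem_singleton.mp hh']; exact hek') hkk hbk hbk'
    · -- SEVERAL HEIGHTS: p716496 with `C₁ = Σ_h`, `C₂ = C(hs′)`
      subst hCn
      have hch'' : ∀ h' ∈ hs', c' - h' ≠ 0 := fun h' hh' => hch h' (List.mem_cons.mpr (Or.inr hh'))
      have hdisj := disjoint_support_heights (K := K) (T := T) (j := j) hnh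
      have h12 := HasSNCWith.mul_of_disjoint hdisj
        (hasSNCWith_𝓘Λ_insert_comap_translate_of_forall_mem_far_translated hjT hch' H₀ fs hjfs hd hC1 hE)
        (hasSNCWith_prod_heights (b := b) (e := e) (c' := c') hjT hs' hnil hnd' hch'' H₀ fs hjfs hd hC1 hE)
      -- the reduced families: off the heights of `hs′` (index 1) and off the height `h` (index 2)
      set H₁ := H₀.filter fun ma => ¬ (ma.1 = j.succ ∧ ∃ h' ∈ hs', ma.2 + h' = 0) with hH₁
      set fs₁ := fs.filter fun k => ¬ (k ∈ T ∧ ∃ h' ∈ hs', e k + b k * h' = 0) with hfs₁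
      set H₂ := H₀.filter fun ma => ¬ (ma.1 = j.succ ∧ ma.2 + h = 0) with hH₂
      set fs₂ := fs.filter fun k => ¬ (k ∈ T ∧ e k + b k * h = 0) with hfs₂
      let P₁ : Scheme.IdealSheafData (P 4 K) → Prop := fun D =>
        D = ⊤ ∨ (∃ ma ∈ H₁, D = ofIdealTop (Ideal.span {(γ 4 K).symm (X ma.1 + C ma.2)})) ∨
          ∃ k ∈ fs₁, D = ofIdealTop (Ideal.span {(γ 4 K).symm ((X k.succ + C (b k)) * X j.succ - C c' * X k.succ + C (e k))})
      let P₂ : Scheme.IdealSheafData (P 4 K) → Prop := fun D =>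
        D = ⊤ ∨ (∃ ma ∈ H₂, D = ofIdealTop (Ideal.span {(γ 4 K).symm (X ma.1 + C ma.2)})) ∨
          ∃ k ∈ fs₂, D = ofIdealTop (Ideal.span {(γ 4 K).symm ((X k.succ + C (b k)) * X j.succ - C c' * X k.succ + C (e k))})
      set E₁ := E.filter fun D => decide (P₁ D) with hE₁
      set E₂ := E.filter fun D => decide (P₂ D) with hE₂
      have hmem₁ : ∀ D ∈ E₁, P₁ D := fun D hD => of_decide_eq_true (List.mem_filter.mp hD).2
      have hmem₂ : ∀ D ∈ E₂, P₂ D := fun D hD => of_decide_eq_true (List.mem_filter.mp hD).2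
      have hnot₁ : ∀ D ∈ E, D ∉ E₁ → ¬ P₁ D := fun D hD hD₁ h => hD₁ (List.mem_filter.mpr ⟨hD, decide_eq_true h⟩)
      have hnot₂ : ∀ D ∈ E, D ∉ E₂ → ¬ P₂ D := fun D hD hD₂ h => hD₂ (List.mem_filter.mpr ⟨hD, decide_eq_true h⟩)
      have hjfs₁ : j ∉ fs₁ := fun h => hjfs (Finset.mem_filter.mp h).1
      have hjfs₂ : j ∉ fs₂ := fun h => hjfs (Finset.mem_filter.mp h).1
      have hbk : ∀ k ∈ fs, ∀ h'' : K, e k + b k * h'' = 0 → b k ≠ 0 := by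
        intro k hk h'' hek hb
        refine hd k hk ?_
        rw [hb, zero_mul, add_zero] at hek
        rw [hek, hb, zero_mul, add_zero]
      have hΛT : ∀ x : P 4 K, x ∈ ((AffineCoordBlowup.𝓘Λ 4 K (insert 0 (Fin.succ '' (T : Set (Fin 4))))).support : Set (P 4 K)) →
          ∀ i ∈ (insert 0 (Fin.succ '' (T : Set (Fin 4))) : Set (Fin (4 + 1))), (X i : A 4 K) ∈ x.asIdeal := fun x hx => by
        rw [SetLike.mem_coe, AffineCoordBlowup.support_𝓘Λ, AffineCoordBlowup.mem_CΛ_iff'] at hx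
        exact hx
      -- a member at height `h''` lies in `Σ_{h''}` over `Zc`
      have hmemS : ∀ (x : P 4 K) (h'' : K), (X j.succ + C (-h'') : A 4 K) ∈ x.asIdeal →
          (∀ i ∈ (insert 0 (Fin.succ '' (T : Set (Fin 4))) : Set (Fin (4 + 1))), (X i : A 4 K) ∈ x.asIdeal) →
          x ∈ (((AffineCoordBlowup.𝓘Λ 4 K (insert 0 (Fin.succ '' ((insert j T : Finset (Fin 4)) : Set (Fin 4))))).comap
            (Spec.map (CommRingCat.ofHom ((AffinePointBlowup.translateEquiv (n := 4) (Pi.single j.succ (-h'')) :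
              A 4 K ≃ₐ[K] A 4 K) : A 4 K →+* A 4 K)))).support : Set (P 4 K)) := fun x h'' hj hZ => by
        rw [SetLike.mem_coe, mem_support_comap_spec_translate_𝓘Λ_iff]
        exact X_add_C_mem_insert_of_hyperplane_mem hjT x (-h'') hj hZ
      show Scheme.IsRegular _ ∧ _ ∧ HasSNCWith (((⟨hypSheaf p F, E, p⟩ : MarkedIdeal (P 4 K)).transform π _).boundary) _
      refine admissible_strictTransform_of_disjoint_repairs hdisj (⟨hypSheaf p F, E, p⟩ : MarkedIdeal (P 4 K))
        (E₁ := E₁) (E₂ := E₂) h12 ?_ ?_ ?_ ?_ hπ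
      · -- the repair at height `h` with the boundary off the heights of `hs′` (p717520)
        intro X₁ τ hτ
        refine admissible_strictTransform_after_farRepair_translated (b := b) (e := e) (c' := c') (δ := h) hjT hch' H₁ fs₁ hjfs₁
          (fun k hk => hd k (Finset.mem_filter.mp hk).1)
          (fun k hk a ha => hC1 k (Finset.mem_filter.mp hk).1 a (Finset.mem_filter.mp ha).1) ?_ ?_ hk₀ hmem₁ F hperm hτ
        · intro a ha hah k hk hkT hek hbk'
          obtain ⟨ha', hna⟩ := Finset.mem_filter.mp ha
          obtain ⟨hk', hnk⟩ := Finset.mem_filter.mp hk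
          refine hHj a ha' (fun h'' hh'' => ?_) k hk' hkT (fun h'' hh'' => ?_) hbk'
          · rcases List.mem_cons.mp hh'' with rfl | hh''
            · exact hah
            · exact fun hc => hna ⟨rfl, h'', hh'', hc⟩
          · rcases List.mem_cons.mp hh'' with rfl | hh''
            · exact hek
            · exact fun hc => hnk ⟨hkT, h'', hh'', hc⟩
        · intro k hk k' hk' hkT hk'T hek hek' hkk hbk₁ hbk₂
          obtain ⟨hk₁, hnk⟩ := Finset.mem_filter.mp hk
          obtain ⟨hk₂, hnk'⟩ := Finset.mem_filter.mp hk'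
          refine hNh k hk₁ k' hk₂ hkT hk'T (fun h'' hh'' => ?_) (fun h'' hh'' => ?_) hkk hbk₁ hbk₂
          · rcases List.mem_cons.mp hh'' with rfl | hh''
            · exact hek
            · exact fun hc => hnk ⟨hkT, h'', hh'', hc⟩
          · rcases List.mem_cons.mp hh'' with rfl | hh''
            · exact hek'
            · exact fun hc => hnk' ⟨hk'T, h'', hh'', hc⟩
      · -- the members at the heights of `hs′` meet `Zc` only inside `V(C(hs′))`
        intro D hD hD₁ x hx
        have hn := hnot₁ D hD hD₁
        obtain ⟨hxD, hxZ⟩ := hx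
        have hZ := hΛT x hxZ
        rw [SetLike.mem_coe, mem_support_prod_heights_iff]
        rcases hE D hD with h0 | ⟨ma, hma, h0⟩ | ⟨k, hk, h0⟩
        · exact absurd (Or.inl h0) hn
        · have hj' : ma.1 = j.succ ∧ ∃ h' ∈ hs', ma.2 + h' = 0 := by
            by_contra hc
            exact hn (Or.inr (Or.inl ⟨ma, Finset.mem_filter.mpr ⟨hma, hc⟩, h0⟩))
          obtain ⟨hm1, h', hh', hma2⟩ := hj'
          rw [h0, SetLike.mem_coe, mem_support_ofIdealTop_span_γ_symm_iff, hm1, eq_neg_of_add_eq_zero_left hma2] at hxD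
          exact ⟨h', hh', hmemS x h' hxD hZ⟩
        · have hk' : k ∈ T ∧ ∃ h' ∈ hs', e k + b k * h' = 0 := by
            by_contra hc
            exact hn (Or.inr (Or.inr ⟨k, Finset.mem_filter.mpr ⟨hk, hc⟩, h0⟩))
          obtain ⟨hkT, h', hh', hek⟩ := hk'
          rw [h0, SetLike.mem_coe, mem_support_ofIdealTop_span_γ_symm_iff] at hxD
          have hXk : (X k.succ : A 4 K) ∈ x.asIdeal := hZ k.succ (Set.mem_insert_of_mem _ ⟨k, Finset.mem_coe.mpr hkT, rfl⟩)
          exact ⟨h', hh', hmemS x h' (X_add_C_mem_of_tquadric_mem x (hbk k hk h' hek) hek hxD hXk) hZ⟩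
      · -- the repair at the heights of `hs′` with the boundary off the height `h` (induction)
        intro X₂ τ hτ
        refine ih hnil hnd' hch'' H₂ fs₂ hjfs₂ (fun k hk => hd k (Finset.mem_filter.mp hk).1)
          (fun k hk a ha => hC1 k (Finset.mem_filter.mp hk).1 a (Finset.mem_filter.mp ha).1) ?_ ?_ hmem₂ rfl hτ
        · intro a ha hah k hk hkT hek hbk'
          obtain ⟨ha', hna⟩ := Finset.mem_filter.mp ha
          obtain ⟨hk', hnk⟩ := Finset.mem_filter.mp hk
          refine hHj a ha' (fun h'' hh'' => ?_) k hk' hkT (fun h'' hh'' => ?_) hbk'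
          · rcases List.mem_cons.mp hh'' with rfl | hh''
            · exact fun hc => hna ⟨rfl, hc⟩
            · exact hah h'' hh''
          · rcases List.mem_cons.mp hh'' with rfl | hh''
            · exact fun hc => hnk ⟨hkT, hc⟩
            · exact hek h'' hh''
        · intro k hk k' hk' hkT hk'T hek hek' hkk hbk₁ hbk₂
          obtain ⟨hk₁, hnk⟩ := Finset.mem_filter.mp hk
          obtain ⟨hk₂, hnk'⟩ := Finset.mem_filter.mp hk'
          refine hNh k hk₁ k' hk₂ hkT hk'T (fun h'' hh'' => ?_) (fun h'' hh'' => ?_) hkk hbk₁ hbk₂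
          · rcases List.mem_cons.mp hh'' with rfl | hh''
            · exact fun hc => hnk ⟨hkT, hc⟩
            · exact hek h'' hh''
          · rcases List.mem_cons.mp hh'' with rfl | hh''
            · exact fun hc => hnk' ⟨hk'T, hc⟩
            · exact hek' h'' hh''
      · -- the members at the height `h` meet `Zc` only inside `Σ_h`
        intro D hD hD₂ x hx
        have hn := hnot₂ D hD hD₂
        obtain ⟨hxD, hxZ⟩ := hx
        have hZ := hΛT x hxZ
        rcases hE D hD with h0 | ⟨ma, hma, h0⟩ | ⟨k, hk, h0⟩
        · exact absurd (Or.inl h0) hn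
        · have hj' : ma.1 = j.succ ∧ ma.2 + h = 0 := by
            by_contra hc
            exact hn (Or.inr (Or.inl ⟨ma, Finset.mem_filter.mpr ⟨hma, hc⟩, h0⟩))
          rw [h0, SetLike.mem_coe, mem_support_ofIdealTop_span_γ_symm_iff, hj'.1, eq_neg_of_add_eq_zero_left hj'.2] at hxD
          exact hmemS x h hxD hZ
        · have hk' : k ∈ T ∧ e k + b k * h = 0 := by
            by_contra hc
            exact hn (Or.inr (Or.inr ⟨k, Finset.mem_filter.mpr ⟨hk, hc⟩, h0⟩))
          rw [h0, SetLike.mem_coe, mem_support_ofIdealTop_span_γ_symm_iff] at hxD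
          have hXk : (X k.succ : A 4 K) ∈ x.asIdeal := hZ k.succ (Set.mem_insert_of_mem _ ⟨k, Finset.mem_coe.mpr hk'.1, rfl⟩)
          exact hmemS x h (X_add_C_mem_of_tquadric_mem x (hbk k hk h hk'.2) hk'.2 hxD hXk) hZ

/-- **THE SAME AS AN ADMISSIBILITY TRIPLE** (BGMW Def. 3.1.3 (1)(2)) for `M' = ((z^p + F)·𝒪, E, p).transform π C(hs)`: after ONE blow-up along the
disjoint union of the resonance loci at the heights `hs`, the strict transform of the escaping centre is an admissible centre. -/
theorem admissible_strictTransform_after_manyHeights_farRepair' (hjT : j ∉ T) (hs : List K) (hne : hs ≠ []) (hnd : hs.Nodup)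
    (hch : ∀ h ∈ hs, c' - h ≠ 0) (H₀ : Finset (Fin (4 + 1) × K)) (fs : Finset (Fin 4)) (hjfs : j ∉ fs)
    (hd : ∀ k ∈ fs, e k + b k * c' ≠ 0) (hC1 : ∀ k ∈ fs, ∀ a : K, (k.succ, a) ∈ H₀ → a = b k)
    (hHj : ∀ a : K, (j.succ, a) ∈ H₀ → (∀ h ∈ hs, a + h ≠ 0) →
      ∀ k ∈ fs, k ∈ T → (∀ h ∈ hs, e k + b k * h ≠ 0) → b k ≠ 0 → e k ≠ a * b k)
    (hNh : ∀ k ∈ fs, ∀ k' ∈ fs, k ∈ T → k' ∈ T → (∀ h ∈ hs, e k + b k * h ≠ 0) → (∀ h ∈ hs, e k' + b k' * h ≠ 0) → k ≠ k' →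
      b k ≠ 0 → b k' ≠ 0 → e k * b k' ≠ e k' * b k)
    {k₀ : Fin 4} (hk₀ : k₀ ∈ T) {E : List (Scheme.IdealSheafData (P 4 K))}
    (hE : ∀ D ∈ E, D = ⊤ ∨ (∃ ma ∈ H₀, D = ofIdealTop (Ideal.span {(γ 4 K).symm (X ma.1 + C ma.2)})) ∨
      ∃ k ∈ fs, D = ofIdealTop (Ideal.span {(γ 4 K).symm ((X k.succ + C (b k)) * X j.succ - C c' * X k.succ + C (e k))}))
    (F : MvPolynomial (Fin 4) K) (hperm : (p : ℕ∞) ≤ CentreBlowup.ordAlong T F) {W : Scheme.{0}} {π : W ⟶ P 4 K}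
    (hπ : IsBlowup π (hs.map fun h => (AffineCoordBlowup.𝓘Λ 4 K (insert 0 (Fin.succ '' ((insert j T : Finset (Fin 4)) : Set (Fin 4))))).comap
      (Spec.map (CommRingCat.ofHom ((AffinePointBlowup.translateEquiv (n := 4) (Pi.single j.succ (-h)) : A 4 K ≃ₐ[K] A 4 K) :
        A 4 K →+* A 4 K)))).prod) :
    let Cn := (hs.map fun h => (AffineCoordBlowup.𝓘Λ 4 K (insert 0 (Fin.succ '' ((insert j T : Finset (Fin 4)) : Set (Fin 4))))).comap
      (Spec.map (CommRingCat.ofHom ((AffinePointBlowup.translateEquiv (n := 4) (Pi.single j.succ (-h)) : A 4 K ≃ₐ[K] A 4 K) :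
        A 4 K →+* A 4 K)))).prod
    let M' := (⟨hypSheaf p F, E, p⟩ : MarkedIdeal (P 4 K)).transform π Cn
    let C' := strictTransformIdeal π Cn (AffineCoordBlowup.𝓘Λ 4 K (insert 0 (Fin.succ '' (T : Set (Fin 4)))))
    Scheme.IsRegular C'.subscheme ∧ (C'.support : Set W) ⊆ M'.support ∧ HasSNCWith M'.boundary C' := by
  obtain ⟨hr, hs', ht⟩ := admissible_strictTransform_after_manyHeights_farRepair hjT hs hne hnd hch H₀ fs hjfs hd hC1 hHj hNh hk₀ hE F
    hperm rfl hπ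
  refine ⟨hr, hs', ?_⟩
  rw [MarkedIdeal.transform_boundary]
  exact ht

end ChartDictionary

end Summit.ResolutionOfSingularities.ResolutionOfSingularities.Theorems.PIDim4

end
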